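import Summits.BirchSwinnertonDyer.BirchSwinnertonDyer.Theorems.ManinLocalTwoThreePinningKernelStaged
import Summits.BirchSwinnertonDyer.BirchSwinnertonDyer.Theorems.ManinLocalTwoThreePinningKernelCusp
import Summits.BirchSwinnertonDyer.BirchSwinnertonDyer.Theorems.ManinLocalTwoThreePinningOneSeventeenTablesC
import Literature.NumberTheory.EllipticCurves.ModularFormsGamma0WeightTwoDimension
import Literature.NumberTheory.EllipticCurves.NewformsStrongMultiplicityOne
import HarnessLib

/-!
# LEVEL 117 (no `η`-quotients) PINNED INSIDE `S₂(Γ₀(234))` (genus 35) BY THE PINNING KERNEL: THE NEWFORM OF EVERY `X₀(117)`-DATUM, FACT-FREE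

Cell `bsd-f2-manin`, route `ManinLocalTwoThree`, crux C3 `ManinPrimeToThreeAtNine` (stmt-BirchSwinnertonDyer-22968, `9 ∣ 117`), an g58
(LENS analytic/periods); `--supports stmt-BirchSwinnertonDyer-22967` (helper, the route's pinning series).  INSTANCE of
`…PinningKernel{Sieve,,Staged,Cusp}`: part B's abstract kernel `exists_smul_eq_sum_of_certs` run in `V = S₂(Γ₀(234))` (`coef = cuspCoeffₗ`,
`dim = g = 35`) for the vector `F = ι₁ D.f = degeneracyMap0 117 234 1 2 D.f` of an `X₀(117)`-datum `D` — `F` has the `q`-expansion of `D.f`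
(tree `coe_degeneracyMap0_one`), so `coef n F = aₙ(W)` and the sieve runs in the LEVEL-117 semantics (`truth_mem_runSieve D`: `a₃ = 0`,
`a_{p^e}` multiplicative at `p ∣ 117`, Hecke at `p ∤ 117`).
WHY THE LIFT: `Γ₀(117)`, `Γ₀(39)`, `Γ₀(13)` carry NO weight-2 `η`-quotients (complete enumeration), and the holomorphic ones of `M₂(Γ₀(117))`
do not span; `S₂(Γ₀(234))` is spanned by cuspidal `η`-quotients (rank 35 at depth 48), the 35 of part 1 (`Ls`, all cusp orders `≤ 16`, `Σ|r_δ| ≤ 14`).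
THE RESULT.  Tables certified to depth 128 (sparse `η` certificates), integer duals `d = 2016`, the staged box sieve over `3, 2, 5, 7, 11, 13` with the
certified column relations leaves exactly 2 prime assignments (`certs`): the 1 rational newform class `117a`
and the `3`-depleted coefficient system of the old class `39a` (consistent with every linear relation of
`S₂(Γ₀(234))`, realised by no datum; harmless: a consumer reads its class off `truth W`).  **`pinning_cusp (D)`**: for every `X₀(117)`-datum `D` of an
elliptic `W/ℚ` there are the basis cusp forms `S` (values = the `η`-quotients of `Ls`) and a certificate `(σ, d′, y) ∈ certs` with `truth W = σ` and
`d′ • ι₁ D.f = Σ_j y_j • S j` in `S₂(Γ₀(234))` (here `d′ = 42`).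
HONEST FRAMING: unconditional, standard axioms; the Néron/`c`-side at `117` is NOT touched (the root `39a` of the twist census `117a = 39a ⊗ χ₋₃` is
not an `η`-product); nothing here proves C2/C3, Manin's conjecture or BSD.
[cite: CremonaAlgorithms1997, §2.10, Table 1 (117a)] [cite: AtkinLehner1970, Thm. 3] [cite: DiamondShurman2005, Thm. 3.5.1, §5.6]
[cite: Koehler2011, §2.1] [cite: Ligozat1975, Ch. 3]
-/

set_option autoImplicit false
-- lint-debt: the directory name repeats the summit name (sibling precedent `ManinLocalTwoThreePinningSixtyThree.lean`)
set_option linter.dupNamespace false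

noncomputable section


open Complex
open UpperHalfPlane hiding I
open scoped MatrixGroups ModularForm
open ModularForm CongruenceSubgroup
open Literature.NumberTheory.ModularForms
open Literature.NumberTheory.EllipticCurves Literature.NumberTheory.EllipticCurves.ModularForms

namespace Summit.BirchSwinnertonDyer.BirchSwinnertonDyer.Theorems.ManinLocalTwoThree.PinningOneSeventeen

open Summit.BirchSwinnertonDyer.BirchSwinnertonDyer.Theorems.ManinLocalTwoThree.BracketSturm
open Summit.BirchSwinnertonDyer.BirchSwinnertonDyer.Theorems.ManinLocalTwoThree.PinningKernel


set_option maxHeartbeats 4000000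
set_option maxRecDepth 16384

/-! ## §3 Duals, relations, the staged sieve (level-117 semantics) -/

/-- **The dual certificate** `⟨dualsᵢ, tabsⱼ⟩ = 2016·δᵢⱼ`. [folklore] -/
theorem hdual : ∀ i j : Fin 35, dotList (duals i) (tabs j) = if i = j then (2016 : ℤ) else 0 := by
  decide +kernel

/-- Sieve stage `0`: the live list `L_0` is mapped into `L_1` (kernel `decide`). [folklore] -/
theorem hst0 : ∀ σ ∈ sieveStep 117 128 ((([[]] : List (List (ℕ × ℤ))) :: lvs).getD 0 []) (stages.getD 0 (0, [])), σ ∈ lvs.getD 0 [] := by decide +kernel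
/-- Sieve stage `1`: the live list `L_1` is mapped into `L_2` (kernel `decide`). [folklore] -/
theorem hst1 : ∀ σ ∈ sieveStep 117 128 ((([[]] : List (List (ℕ × ℤ))) :: lvs).getD 1 []) (stages.getD 1 (0, [])), σ ∈ lvs.getD 1 [] := by decide +kernel
/-- Sieve stage `2`: the live list `L_2` is mapped into `L_3` (kernel `decide`). [folklore] -/
theorem hst2 : ∀ σ ∈ sieveStep 117 128 ((([[]] : List (List (ℕ × ℤ))) :: lvs).getD 2 []) (stages.getD 2 (0, [])), σ ∈ lvs.getD 2 [] := by decide +kernel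
/-- Stage 3 (`p = 7`, 45 live × box 11) is certified in 9 chunks. [folklore] -/
def chunks3 : List (List (List (ℕ × ℤ))) :=
  [[[(3, 0), (2, -2), (5, -4)], [(3, 0), (2, -2), (5, -3)], [(3, 0), (2, -2), (5, -2)], [(3, 0), (2, -2), (5, -1)], [(3, 0), (2, -2), (5, 0)]],
   [[(3, 0), (2, -2), (5, 1)], [(3, 0), (2, -2), (5, 2)], [(3, 0), (2, -2), (5, 3)], [(3, 0), (2, -2), (5, 4)], [(3, 0), (2, -1), (5, -4)]],
   [[(3, 0), (2, -1), (5, -3)], [(3, 0), (2, -1), (5, -2)], [(3, 0), (2, -1), (5, -1)], [(3, 0), (2, -1), (5, 0)], [(3, 0), (2, -1), (5, 1)]],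
   [[(3, 0), (2, -1), (5, 2)], [(3, 0), (2, -1), (5, 3)], [(3, 0), (2, -1), (5, 4)], [(3, 0), (2, 0), (5, -4)], [(3, 0), (2, 0), (5, -3)]],
   [[(3, 0), (2, 0), (5, -2)], [(3, 0), (2, 0), (5, -1)], [(3, 0), (2, 0), (5, 0)], [(3, 0), (2, 0), (5, 1)], [(3, 0), (2, 0), (5, 2)]],
   [[(3, 0), (2, 0), (5, 3)], [(3, 0), (2, 0), (5, 4)], [(3, 0), (2, 1), (5, -4)], [(3, 0), (2, 1), (5, -3)], [(3, 0), (2, 1), (5, -2)]],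
   [[(3, 0), (2, 1), (5, -1)], [(3, 0), (2, 1), (5, 0)], [(3, 0), (2, 1), (5, 1)], [(3, 0), (2, 1), (5, 2)], [(3, 0), (2, 1), (5, 3)]],
   [[(3, 0), (2, 1), (5, 4)], [(3, 0), (2, 2), (5, -4)], [(3, 0), (2, 2), (5, -3)], [(3, 0), (2, 2), (5, -2)], [(3, 0), (2, 2), (5, -1)]],
   [[(3, 0), (2, 2), (5, 0)], [(3, 0), (2, 2), (5, 1)], [(3, 0), (2, 2), (5, 2)], [(3, 0), (2, 2), (5, 3)], [(3, 0), (2, 2), (5, 4)]]]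
/-- Sieve stage `3`, chunk `0` (kernel `decide`). [folklore] -/
theorem hst3c0 : ∀ σ ∈ sieveStep 117 128 (chunks3.getD 0 []) (stages.getD 3 (0, [])), σ ∈ lvs.getD 3 [] := by decide +kernel
/-- Sieve stage `3`, chunk `1` (kernel `decide`). [folklore] -/
theorem hst3c1 : ∀ σ ∈ sieveStep 117 128 (chunks3.getD 1 []) (stages.getD 3 (0, [])), σ ∈ lvs.getD 3 [] := by decide +kernel
/-- Sieve stage `3`, chunk `2` (kernel `decide`). [folklore] -/
theorem hst3c2 : ∀ σ ∈ sieveStep 117 128 (chunks3.getD 2 []) (stages.getD 3 (0, [])), σ ∈ lvs.getD 3 [] := by decide +kernel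
/-- Sieve stage `3`, chunk `3` (kernel `decide`). [folklore] -/
theorem hst3c3 : ∀ σ ∈ sieveStep 117 128 (chunks3.getD 3 []) (stages.getD 3 (0, [])), σ ∈ lvs.getD 3 [] := by decide +kernel
/-- Sieve stage `3`, chunk `4` (kernel `decide`). [folklore] -/
theorem hst3c4 : ∀ σ ∈ sieveStep 117 128 (chunks3.getD 4 []) (stages.getD 3 (0, [])), σ ∈ lvs.getD 3 [] := by decide +kernel
/-- Sieve stage `3`, chunk `5` (kernel `decide`). [folklore] -/
theorem hst3c5 : ∀ σ ∈ sieveStep 117 128 (chunks3.getD 5 []) (stages.getD 3 (0, [])), σ ∈ lvs.getD 3 [] := by decide +kernel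
/-- Sieve stage `3`, chunk `6` (kernel `decide`). [folklore] -/
theorem hst3c6 : ∀ σ ∈ sieveStep 117 128 (chunks3.getD 6 []) (stages.getD 3 (0, [])), σ ∈ lvs.getD 3 [] := by decide +kernel
/-- Sieve stage `3`, chunk `7` (kernel `decide`). [folklore] -/
theorem hst3c7 : ∀ σ ∈ sieveStep 117 128 (chunks3.getD 7 []) (stages.getD 3 (0, [])), σ ∈ lvs.getD 3 [] := by decide +kernel
/-- Sieve stage `3`, chunk `8` (kernel `decide`). [folklore] -/
theorem hst3c8 : ∀ σ ∈ sieveStep 117 128 (chunks3.getD 8 []) (stages.getD 3 (0, [])), σ ∈ lvs.getD 3 [] := by decide +kernel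
/-- Sieve stage `3`: the live list `L_3` is mapped into `L_4` (kernel `decide`, chunked). [folklore] -/
theorem hst3 : ∀ σ ∈ sieveStep 117 128 ((([[]] : List (List (ℕ × ℤ))) :: lvs).getD 3 []) (stages.getD 3 (0, [])), σ ∈ lvs.getD 3 [] :=
  sieveStep_subset_of_chunks 117 128 chunks3 (by decide +kernel) fun j hj ↦ by
    have hj' : j < 9 := lt_of_lt_of_eq hj (by decide)
    interval_cases j
    exacts [hst3c0, hst3c1, hst3c2, hst3c3, hst3c4, hst3c5, hst3c6, hst3c7, hst3c8]
/-- Sieve stage `4`: the live list `L_4` is mapped into `L_5` (kernel `decide`). [folklore] -/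
theorem hst4 : ∀ σ ∈ sieveStep 117 128 ((([[]] : List (List (ℕ × ℤ))) :: lvs).getD 4 []) (stages.getD 4 (0, [])), σ ∈ lvs.getD 4 [] := by decide +kernel
/-- Sieve stage `5`: the live list `L_5` is mapped into `L_6` (kernel `decide`). [folklore] -/
theorem hst5 : ∀ σ ∈ sieveStep 117 128 ((([[]] : List (List (ℕ × ℤ))) :: lvs).getD 5 []) (stages.getD 5 (0, [])), σ ∈ lvs.getD 5 [] := by decide +kernel

/-- **THE SIEVE** (level-117 semantics), certified one stage at a time (`hst0 … hst5`), assembled by `PinningKernel.runSieve_subset_of_chain`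
(part D `…PinningKernelStaged`): the staged box sieve returns only assignments listed in `certs`. [cite: CremonaAlgorithms1997, §2.10] -/
theorem hcover : ∀ σ ∈ runSieve 117 128 stages, σ ∈ certs.map Prod.fst := by
  have hch : ∀ k < stages.length, ∀ σ ∈ sieveStep 117 128 ((([[]] : List (List (ℕ × ℤ))) :: lvs).getD k [])
      (stages.getD k (0, [])), σ ∈ lvs.getD k [] := by
    intro k hk
    have hk' : k < 6 := lt_of_lt_of_eq hk (by decide)
    interval_cases k
    exacts [hst0, hst1, hst2, hst3, hst4, hst5]
  have hlast : ((([[]] : List (List (ℕ × ℤ))) :: lvs).getD stages.length []) = certs.map Prod.fst := by decide +kernel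
  exact fun σ hσ ↦ hlast ▸ runSieve_subset_of_chain 117 128 stages lvs (by decide) hch σ hσ

/-- **The coordinate certificates** `d'·aₙ(σ) = Σ_j y_j·tabsⱼ[n]` on the dual support (level-117 evaluation). [folklore] -/
theorem hpiv : ∀ c ∈ certs, ∀ i : Fin 35, ∀ n < (duals i).length, (duals i).getD n 0 ≠ 0 →
    (evalOpt 117 c.1 n).map (fun x ↦ c.2.1 * x) = some (∑ j : Fin 35, c.2.2.getD (j : ℕ) 0 * (tabs j).getD n 0) := by
  decide +kernel

/-! ## §4 `dim S₂(Γ₀(234)) = 35` -/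

/-- `μ(Γ₀(234)) = 504`, `ν_∞ = 16`, `ν₂ = ν₃ = 0`. [cite: DiamondShurman2005, §3.8] -/
theorem gamma0_data : gamma0Index 234 = 504 ∧ nuInfty 234 = 16 ∧ nu₂ 234 = 0 ∧ nu₃ 234 = 0 := by
  refine ⟨?_, by decide, by rw [nu₂_eq_card]; decide, by rw [nu₃_eq_card]; decide⟩
  · rw [(gamma0Index_mul (m := 2) (n := 117) (by norm_num)), (gamma0Index_mul (m := 9) (n := 13) (by norm_num)),
      gamma0Index_prime (by norm_num : Nat.Prime 2),
      show (9 : ℕ) = 3 ^ 2 by norm_num, gamma0Index_prime_pow (p := 3) (e := 2) Nat.prime_three (by norm_num),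
      gamma0Index_prime (by norm_num : Nat.Prime 13)]
    norm_num

/-- **`dim S₂(Γ₀(234)) = 35`** (the genus; `μ = 504`, `ν_∞ = 16`), by the tree's `finrank_cuspForm_two_eq_genusX0_holds`.
[cite: DiamondShurman2005, Thm. 3.5.1] -/
theorem finrank_cuspForm_two : Module.finrank ℂ (CuspForm (Gamma0 234) 2) = 35 := by
  obtain ⟨h1, h2, h3, h4⟩ := gamma0_data
  have h : Module.finrank ℂ (CuspForm (Gamma0 234) 2) = genusX0 234 := finrank_cuspForm_two_eq_genusX0_holds 234
  rw [h, genusX0, h1, h2, h3, h4]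

/-! ## §5 The pinning (2 certificates; kernel in `S₂(Γ₀(234))`, vector `ι₁ D.f`) -/

/-- The level lift keeps the coefficients: `aₙ(ι₁ D.f) = aₙ(W)`. [cite: DiamondShurman2005, §5.6] -/
theorem cuspCoeff_iota_f {W : WeierstrassCurve ℚ} (D : ModularParametrizationData W 117) (n : ℕ) :
    cuspCoeff (degeneracyMap0 117 234 1 2 D.f) n = ((W.LFunction n : ℤ) : ℂ) := by
  have h : cuspCoeff (degeneracyMap0 117 234 1 2 D.f) n = cuspCoeff D.f n := by
    unfold cuspCoeff; rw [coe_degeneracyMap0_one 117 234 2 (by norm_num) D.f]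
  rw [h]; exact D.isNewformOf.2 n

/-- **LEVEL 117 PINNED INSIDE `S₂(Γ₀(234))`.**  For every `X₀(117)`-datum `D` of an elliptic `W/ℚ`: with the basis cusp forms `S` (the 35
cuspidal `η`-quotients of `Ls`, level 234), for some certificate `c = (σ, d', y) ∈ certs` the sieve truth of `W` over `3, 2, 5, 7, 11, 13` is `σ` and
`d' • ι₁ D.f = Σ_j y_j • S j`, `ι₁ = degeneracyMap0 117 234 1 2` (same `q`-expansion as `D.f`).
[cite: CremonaAlgorithms1997, §2.10, Table 1 (117a)] [cite: AtkinLehner1970, Thm. 3] [cite: DiamondShurman2005, §5.6] -/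
theorem pinning_cusp {W : WeierstrassCurve ℚ} [W.IsElliptic] (D : ModularParametrizationData W 117) :
    ∃ S : Fin 35 → CuspForm (Gamma0 234) 2, (∀ i, ∀ τ : ℍ, S i τ = etaQuotient 234 (expFn (Ls[(i : ℕ)]).1) τ) ∧
      ∃ c ∈ certs, truth W (stages.map Prod.fst) = c.1 ∧
        ((c.2.1 : ℤ) : ℂ) • degeneracyMap0 117 234 1 2 D.f = ∑ j : Fin 35, ((c.2.2.getD (j : ℕ) 0 : ℤ) : ℂ) • S j := by
  have hlen : ∀ i : Fin 35, (duals i).length ≤ 128 := by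
    decide +kernel
  have hrel : ∀ st ∈ stages, ∀ v ∈ st.2, v.length ≤ 128 ∧ ∀ j : Fin 35, dotList v (tabs j) = 0 := by
    decide +kernel
  have hps : ∀ st ∈ stages, st.1.Prime := by
    intro st hst
    have h : st.1 ∈ stages.map Prod.fst := List.mem_map.mpr ⟨st, hst, rfl⟩
    have hl : stages.map Prod.fst = [3, 2, 5, 7, 11, 13] := by decide
    rw [hl] at h
    simp only [List.mem_cons, List.mem_nil_iff, or_false] at h
    rcases h with h | h | h | h | h | h <;> rw [h] <;> norm_num
  obtain ⟨S, hS⟩ := exists_etaCuspForms 234 Ls hcusp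
  obtain ⟨C, hCS⟩ : ∃ C : Fin 35 → ModularForm (Gamma0 234) 2, ∀ i, ModularFormClass.modularForm (S i) = C i :=
    ⟨_, fun _ ↦ rfl⟩
  have hC : ∀ i, ∀ τ : ℍ, C i τ = etaQuotient 234 (expFn (Ls[(i : ℕ)]).1) τ := fun i τ ↦ by rw [← hCS]; exact hS i τ
  have ht := tables_of_etaCertsSparse 234 128 (fun i : Fin 35 ↦ expFn (Ls[(i : ℕ)]).1) (fun i ↦ shifts i) tabs C hC hshift hcert
  have hs : ∀ i, ∀ n < 128, (((tabs i).getD n 0 : ℤ) : ℂ) = cuspCoeffₗ (one_mem_strictPeriods_coe_gamma0 234) n (S i) :=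
    fun i n hn ↦ by rw [cuspCoeffₗ_apply, ← modCoefₗ_modularForm (S i) n, hCS]; exact ht i n hn
  haveI : FiniteDimensional ℂ (CuspForm (Gamma0 234) 2) := finiteDimensional_cuspForm_gamma0 234 2
  have hF : ∀ n, cuspCoeffₗ (one_mem_strictPeriods_coe_gamma0 234) n (degeneracyMap0 117 234 1 2 D.f) = ((W.LFunction n : ℤ) : ℂ) :=
    fun n ↦ by rw [cuspCoeffₗ_apply]; exact cuspCoeff_iota_f D n
  obtain ⟨c, hc, hc1, hpin⟩ := exists_smul_eq_sum_of_certs D (degeneracyMap0 117 234 1 2 D.f) hF S tabs duals 2016 hs hlen hdual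
    (by norm_num) finrank_cuspForm_two stages hps hrel certs hcover hpiv
  exact ⟨S, hS, c, hc, hc1.symm, hpin⟩

end Summit.BirchSwinnertonDyer.BirchSwinnertonDyer.Theorems.ManinLocalTwoThree.PinningOneSeventeen

end
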